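import Summits.QuantumFields.YangMills.Theorems.ParabolicTrajectoryLatticeGapOnTrajectoryTransferReduction
import Literature.MathematicalPhysics.QuantumFieldTheory.SpeciesLatticeProducts
import Literature.MathematicalPhysics.QuantumLattice.ReflectedCorrelationPolarisation
import HarnessLib

/-!
# Crux `LatticeGapOnTrajectory` (stmt-QuantumFields-10523), line `orbit-kantorovich-finite-size`:
# limits of lattice representatives along `IsYangMillsFor` (transfer half, A2)

Helper file (`--supports stmt-QuantumFields-10523`) for the registered stub `stub_transfer`: the
`k → ∞` limits, under `IsYangMillsFor r S T` for ONE scheme `S` with reflection-symmetric witness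
renormalisations, of the lattice representatives of `Literature/…/SpeciesLatticeProducts`
(`obsProd`, `SlabSum.rep`), feeding the bridge `TorusOSGap → transfer clause`
(`…TransferFromOSGap`). For slab-ordered real product tensors `P = ⊗ fᵢ`, `Q = ⊗ gⱼ`:

* `latticeSchwinger_tendsto_of_isOffDiagonal` (all degrees; degree `0` by E0 and `μ_k(1) = 1`);
* `integral_obsProd_tendsto` (`∫ X_Q dμ_k → 𝔖_m^{σ'}(Q)`), `integral_obsProd_reflected_tendsto`
  (`∫ X_P dμ_k → 𝔖_n^{Θσ∘rev}(ΘP*)`, by `Θ'`-invariance and the reflection identity) and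
  `integral_obsProd_reflect_mul_shift_tendsto`
  (`∫ X_P(Θ'U) X_Q(τ_{s_k}U) dμ_k → 𝔖_{n+m}^{Θσ∘rev ++ σ'}(ΘP* ⊗ T_t Q)` when `a_k s_k = t` eventually:
  eventually the integral IS the lattice Schwinger function of the append tensor, an off-diagonal
  real product tensor — `isOffDiagonal_osAdjoint_appendTensor_translateMulti_of_slabs` of
  `…TransferReduction` — which is all `IsYangMillsFor` constrains);
* by (sesqui)linearity the same for slab sums `F = Σ cᵢ Pᵢ`, `G' = Σ dⱼ Qⱼ` and their representatives:
  `tendsto_integral_rep`, `tendsto_conj_integral_rep`, `tendsto_integral_conj_rep_mul_rep`.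

References: Osterwalder–Seiler 1978 §2; Glimm–Jaffe 1987 §6.1; `…TransferReduction`,
`SpeciesTimeReflection`, `SpeciesLatticeProducts`.
-/

open scoped SchwartzMap Topology ComplexConjugate
open Filter Set MeasureTheory
open Literature.MathematicalPhysics.AQFT Literature.MathematicalPhysics.QuantumLattice
open Literature.MathematicalPhysics.QuantumFieldTheory

noncomputable section

namespace Summit.QuantumFields.YangMills.Cruxes.LatticeGapOnTrajectory.OrbitKantorovichFiniteSize

namespace Transfer

section Limits

variable {G : Type} [Group G] [TopologicalSpace G] [IsTopologicalGroup G] [CompactSpace G]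
  [MeasurableSpace G] [BorelSpace G]

/-- **Lattice Schwinger functions converge on off-diagonal real product tensors** (all degrees:
`IsYangMillsFor` for `n ≥ 1`, E0 and `μ_k(1) = 1` for `n = 0`). [cite: JaffeWitten2000, §6] -/
theorem latticeSchwinger_tendsto_of_isOffDiagonal (r : LatticeRep G) {S : SpeciesScheme (YMSpecies G)}
    {T : OSData (YMSpecies G) 4} (hT : IsYangMillsFor r S T) {N : ℕ} (σ : Fin N → YMSpecies G)
    (f : Fin N → 𝓢(EuclideanSpace ℝ (Fin 4), ℝ)) {P : 𝓢((Fin N → EuclideanSpace ℝ (Fin 4)), ℂ)}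
    (hP : IsTensorOf P fun i => ofRealTest (f i)) (hoff : IsOffDiagonal P) :
    Tendsto (fun k => ((latticeSchwinger r.ρ S (fun s => s.F) k N σ f : ℝ) : ℂ)) atTop
      (𝓝 (T.schwinger N σ P)) := by
  rcases Nat.eq_zero_or_pos N with rfl | hN
  · have h1 : T.schwinger 0 σ P = 1 := by rw [T.normalized σ P, hP]; simp
    have h2 : ∀ k, latticeSchwinger r.ρ S (fun s => s.F) k 0 σ f = 1 := fun k => by
      haveI := isProbabilityMeasure_wilsonMeasure (d := 4) (L := S.side k) r.ρ r.continuous (S.β k)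
      simp [latticeSchwinger]
    rw [h1]
    simp only [h2, Complex.ofReal_one]
    exact tendsto_const_nhds
  · exact hT N hN.ne' σ f P hP hoff

/-- The OS adjoint `ΘP*` of a slab-ordered real product tensor is off-diagonal (its factors live in
the pairwise disjoint reflected slabs). [cite: OsterwalderSchraderCMP1973, §2 (2.4)] -/
theorem osAdjoint_isOffDiagonal_of_slabs {n : ℕ} {P : 𝓢((Fin n → EuclideanSpace ℝ (Fin 4)), ℂ)}
    {f : Fin n → 𝓢(EuclideanSpace ℝ (Fin 4), ℝ)} (hP : IsTensorOf P fun i => ofRealTest (f i))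
    {lo hi : Fin n → ℝ} (hord : ∀ i j, i < j → hi i < lo j)
    (hsupp : ∀ i, tsupport (f i : EuclideanSpace ℝ (Fin 4) → ℝ) ⊆ {x | lo i ≤ x 0 ∧ x 0 ≤ hi i}) :
    IsOffDiagonal (osAdjoint P) := by
  have hT := hP.osAdjoint
  refine IsOffDiagonal.of_tsupport_subset fun x hx => ?_
  have hxi : ∀ i, lo (Fin.rev i) ≤ -x i 0 ∧ -x i 0 ≤ hi (Fin.rev i) := fun i => by
    have hmem := tsupport_ofRealTest_subset _ (hT.tsupport_subset hx i)
    have h1 := hsupp (Fin.rev i) (tsupport_thetaTest_subset _ hmem)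
    rw [Set.mem_setOf_eq, timeReflection_apply, if_pos rfl] at h1
    exact h1
  refine not_mem_coincidenceLocus_of_injective fun i j hij => ?_
  by_contra hne
  have h0 : x i 0 = x j 0 := by rw [hij]
  rcases lt_or_gt_of_ne hne with hlt | hlt
  · linarith [(hxi i).1, (hxi j).2, hord _ _ (Fin.rev_lt_rev.2 hlt)]
  · linarith [(hxi j).1, (hxi i).2, hord _ _ (Fin.rev_lt_rev.2 hlt)]

/-- **One-point limit**: `∫ obsProd S k σ' g dμ_k → 𝔖_m^{σ'}(Q)` for a slab-ordered real product
tensor `Q = ⊗ⱼ gⱼ`. [cite: JaffeWitten2000, §6] -/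
theorem integral_obsProd_tendsto (r : LatticeRep G) {S : SpeciesScheme (YMSpecies G)}
    {T : OSData (YMSpecies G) 4} (hT : IsYangMillsFor r S T) {m : ℕ} (σ' : Fin m → YMSpecies G)
    {Q : 𝓢((Fin m → EuclideanSpace ℝ (Fin 4)), ℂ)} {g : Fin m → 𝓢(EuclideanSpace ℝ (Fin 4), ℝ)}
    (hQ : IsTensorOf Q fun j => ofRealTest (g j)) {lo' hi' : Fin m → ℝ} (hlo' : ∀ j, 0 < lo' j)
    (hord' : ∀ i j, i < j → hi' i < lo' j)
    (hsupp' : ∀ j, tsupport (g j : EuclideanSpace ℝ (Fin 4) → ℝ) ⊆ {x | lo' j ≤ x 0 ∧ x 0 ≤ hi' j}) :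
    Tendsto (fun k => ∫ U, ((obsProd S k σ' g U : ℝ) : ℂ) ∂(wilsonMeasure r.ρ (S.β k))) atTop
      (𝓝 (T.schwinger m σ' Q)) := by
  refine (latticeSchwinger_tendsto_of_isOffDiagonal r hT σ' g hQ
    (isTimeOrdered_of_isTensorOf_slabs hQ hlo' hord' hsupp').isOffDiagonal).congr fun k => ?_
  rw [integral_complex_ofReal]
  rfl

variable {S : SpeciesScheme (YMSpecies G)}

/-- **Reflected one-point limit**: `∫ obsProd S k σ f dμ_k → 𝔖_n^{Θσ ∘ rev}(ΘP*)` (by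
`Θ'`-invariance of Wilson's measure and the reflection identity the integral is the lattice
Schwinger function whose tensor is the off-diagonal OS adjoint `ΘP*`). [cite: OsterwalderSeiler1978, §2] -/
theorem integral_obsProd_reflected_tendsto (r : LatticeRep G) {T : OSData (YMSpecies G) 4}
    (hT : IsYangMillsFor r S T) (hsym : S.IsReflectionSymmetric) {n : ℕ} (σ : Fin n → YMSpecies G)
    {P : 𝓢((Fin n → EuclideanSpace ℝ (Fin 4)), ℂ)} {f : Fin n → 𝓢(EuclideanSpace ℝ (Fin 4), ℝ)}
    (hP : IsTensorOf P fun i => ofRealTest (f i)) {lo hi : Fin n → ℝ}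
    (hord : ∀ i j, i < j → hi i < lo j)
    (hsupp : ∀ i, tsupport (f i : EuclideanSpace ℝ (Fin 4) → ℝ) ⊆ {x | lo i ≤ x 0 ∧ x 0 ≤ hi i}) :
    Tendsto (fun k => ∫ U, ((obsProd S k σ f U : ℝ) : ℂ) ∂(wilsonMeasure r.ρ (S.β k))) atTop
      (𝓝 (T.schwinger n ((fun i => (σ i).timeReflect) ∘ Fin.rev) (osAdjoint P))) := by
  refine (latticeSchwinger_tendsto_of_isOffDiagonal r hT ((fun i => (σ i).timeReflect) ∘ Fin.rev)
    (fun i => thetaTest 4 (f (Fin.rev i))) hP.osAdjoint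
    (osAdjoint_isOffDiagonal_of_slabs hP hord hsupp)).congr fun k => ?_
  rw [integral_complex_ofReal, latticeSchwinger,
    ← integral_comp_negReflect_eq r.ρ r.continuous (S.β k) (obsProd S k σ f)]
  congr 1
  refine integral_congr_ae (Eventually.of_forall fun U => ?_)
  exact prod_smearedLatticeField_reflected hsym k σ f U

/-- **Reflected–translated two-point limit** for slab-ordered real product tensors `P = ⊗ fᵢ`
(lattice species `σ`), `Q = ⊗ gⱼ` (species `σ'`), `t ≥ 0`, shifts `s_k` with `a_k s_k = t`
eventually: `∫ obsProd σ f (Θ'U) · obsProd σ' g (τ_{s_k} U) dμ_k → 𝔖_{n+m}^{Θσ∘rev ++ σ'}(ΘP* ⊗ T_t Q)`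
(eventually the integral IS the lattice Schwinger function of the append tensor, an off-diagonal
real product tensor on which `IsYangMillsFor` gives convergence). [cite: OsterwalderSeiler1978, §2] -/
theorem integral_obsProd_reflect_mul_shift_tendsto (r : LatticeRep G) {S : SpeciesScheme (YMSpecies G)}
    {T : OSData (YMSpecies G) 4} (hT : IsYangMillsFor r S T) (hsym : S.IsReflectionSymmetric) {n m : ℕ}
    (σ : Fin n → YMSpecies G) (σ' : Fin m → YMSpecies G)
    {P : 𝓢((Fin n → EuclideanSpace ℝ (Fin 4)), ℂ)} {Q : 𝓢((Fin m → EuclideanSpace ℝ (Fin 4)), ℂ)}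
    {f : Fin n → 𝓢(EuclideanSpace ℝ (Fin 4), ℝ)} {g : Fin m → 𝓢(EuclideanSpace ℝ (Fin 4), ℝ)}
    (hP : IsTensorOf P fun i => ofRealTest (f i)) (hQ : IsTensorOf Q fun j => ofRealTest (g j))
    {lo hi : Fin n → ℝ} {lo' hi' : Fin m → ℝ} (hlo : ∀ i, 0 < lo i) (hlo' : ∀ j, 0 < lo' j)
    (hord : ∀ i j, i < j → hi i < lo j) (hord' : ∀ i j, i < j → hi' i < lo' j)
    (hsupp : ∀ i, tsupport (f i : EuclideanSpace ℝ (Fin 4) → ℝ) ⊆ {x | lo i ≤ x 0 ∧ x 0 ≤ hi i})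
    (hsupp' : ∀ j, tsupport (g j : EuclideanSpace ℝ (Fin 4) → ℝ) ⊆ {x | lo' j ≤ x 0 ∧ x 0 ≤ hi' j})
    {t : ℝ} (ht : 0 ≤ t) {s : ℕ → ℕ} (hs : ∀ᶠ k in atTop, S.a k * (s k : ℝ) = t) :
    Tendsto (fun k => ∫ U, conj ((obsProd S k σ f U.negReflect : ℝ) : ℂ) *
        ((obsProd S k σ' g (torusTimeShift (S.side k) (s k) U) : ℝ) : ℂ) ∂(wilsonMeasure r.ρ (S.β k)))
      atTop (𝓝 (T.schwinger (n + m) (Fin.append ((fun i => (σ i).timeReflect) ∘ Fin.rev) σ')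
        ((osAdjoint P).appendTensor (translateMulti (EuclideanSpace.single 0 t) Q)))) := by
  have hlim := latticeSchwinger_tendsto_of_isOffDiagonal r hT (Fin.append ((fun i => (σ i).timeReflect) ∘ Fin.rev) σ')
    _ (isTensorOf_osAdjoint_appendTensor_translateMulti hP hQ (EuclideanSpace.single 0 t))
    (isOffDiagonal_osAdjoint_appendTensor_translateMulti_of_slabs hP hQ hlo hlo' hord hord' hsupp
      hsupp' ht)
  refine hlim.congr' ?_
  have hfit : ∀ᶠ k in atTop, ∀ j, hi' j + t ≤ S.a k * S.L k :=
    eventually_all.2 fun j => S.tendsto_L.eventually_ge_atTop _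
  filter_upwards [hs, hfit] with k hk hfk
  simp_rw [Complex.conj_ofReal, ← Complex.ofReal_mul]
  rw [integral_complex_ofReal, latticeSchwinger]
  congr 1
  refine integral_congr_ae (Eventually.of_forall fun U => ?_)
  dsimp only
  rw [Fin.prod_univ_add]
  simp only [Fin.append_left, Fin.append_right, Function.comp_apply]
  rw [prod_smearedLatticeField_reflected hsym k σ f U, obsProd]
  congr 1
  refine Finset.prod_congr rfl fun j _ => ?_
  rw [← hk]
  exact smearedLatticeField_translateTest_torusLift _ _ (S.a_pos k) _ _ (hlo' j).le (hsupp' j)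
    (by rw [hk]; exact hfk j) U

end Limits

/-! ## Slab sums -/

section SlabSums

variable {G : Type} [Group G] [TopologicalSpace G] [IsTopologicalGroup G] [CompactSpace G]
  [MeasurableSpace G] [BorelSpace G]
variable (r : LatticeRep G) {S : SpeciesScheme (YMSpecies G)} {T : OSData (YMSpecies G) 4} {n : ℕ}

/-- **One-point limit of a representative**: `∫ rep D σ dμ_k → 𝔖_n^{σ}(Σ cᵢ Pᵢ)`. [cite: JaffeWitten2000, §6] -/
theorem tendsto_integral_rep (hT : IsYangMillsFor r S T) (D : SlabSum n) (σ : Fin n → YMSpecies G) :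
    Tendsto (fun k => ∫ U, D.rep S σ k U ∂(wilsonMeasure r.ρ (S.β k))) atTop
      (𝓝 (T.schwinger n σ D.sum)) := by
  simp_rw [SlabSum.integral_rep r, SlabSum.sum, map_sum, map_smul, smul_eq_mul]
  exact tendsto_finsetSum _ fun i _ =>
    (integral_obsProd_tendsto r hT σ (D.isTensorOf i) (D.lo_pos i) (D.ord i) (D.supp i)).const_mul _

/-- **Reflected one-point limit of a representative**: `conj ∫ rep D σ dμ_k → 𝔖_n^{Θσ∘rev}(ΘF*)`,
`F = Σ cᵢ Pᵢ` (the integrals of the `obsProd fᵢ` are real). [cite: OsterwalderSeiler1978, §2] -/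
theorem tendsto_conj_integral_rep (hT : IsYangMillsFor r S T) (hsym : S.IsReflectionSymmetric)
    (D : SlabSum n) (σ : Fin n → YMSpecies G) :
    Tendsto (fun k => conj (∫ U, D.rep S σ k U ∂(wilsonMeasure r.ρ (S.β k)))) atTop
      (𝓝 (T.schwinger n ((fun i => (σ i).timeReflect) ∘ Fin.rev) (osAdjoint D.sum))) := by
  have h : ∀ k, conj (∫ U, D.rep S σ k U ∂(wilsonMeasure r.ρ (S.β k))) =
      ∑ i, conj (D.c i) * ∫ U, ((obsProd S k σ (D.f i) U : ℝ) : ℂ) ∂(wilsonMeasure r.ρ (S.β k)) := by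
    intro k
    rw [SlabSum.integral_rep r, map_sum]
    refine Finset.sum_congr rfl fun i _ => ?_
    rw [map_mul, integral_complex_ofReal, Complex.conj_ofReal]
  simp_rw [h, SlabSum.osAdjoint_sum, map_sum, map_smul, smul_eq_mul]
  exact tendsto_finsetSum _ fun i _ =>
    (integral_obsProd_reflected_tendsto r hT hsym σ (D.isTensorOf i) (D.ord i) (D.supp i)).const_mul _

/-- **Reflected–translated two-point limit of representatives**: for slab sums `F = Σ cᵢ Pᵢ`
(arity `n`, lattice species `σ`) and `G' = Σ dⱼ Qⱼ` (arity `m`, species `σ'`), `t ≥ 0` and shifts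
with `a_k s_k = t` eventually,
`∫ conj rep_F(Θ'U) · rep_{G'}(τ_{s_k}U) dμ_k → 𝔖_{n+m}^{Θσ∘rev ++ σ'}(ΘF* ⊗ T_t G')`. [cite: OsterwalderSeiler1978, §2] -/
theorem tendsto_integral_conj_rep_mul_rep (r : LatticeRep G) {S : SpeciesScheme (YMSpecies G)}
    {T : OSData (YMSpecies G) 4} (hT : IsYangMillsFor r S T) (hsym : S.IsReflectionSymmetric)
    {m : ℕ} (D : SlabSum n) (D' : SlabSum m) (σ : Fin n → YMSpecies G) (σ' : Fin m → YMSpecies G)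
    {t : ℝ} (ht : 0 ≤ t) {s : ℕ → ℕ} (hs : ∀ᶠ k in atTop, S.a k * (s k : ℝ) = t) :
    Tendsto (fun k => ∫ U, conj (D.rep S σ k U.negReflect) *
        D'.rep S σ' k (torusTimeShift (S.side k) (s k) U) ∂(wilsonMeasure r.ρ (S.β k))) atTop
      (𝓝 (T.schwinger (n + m) (Fin.append ((fun i => (σ i).timeReflect) ∘ Fin.rev) σ')
        ((osAdjoint D.sum).appendTensor (translateMulti (EuclideanSpace.single 0 t) D'.sum)))) := by
  have hexp : ∀ k, ∫ U, conj (D.rep S σ k U.negReflect) *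
      D'.rep S σ' k (torusTimeShift (S.side k) (s k) U) ∂(wilsonMeasure r.ρ (S.β k)) =
      ∑ i, ∑ j, conj (D.c i) * D'.c j * ∫ U, conj ((obsProd S k σ (D.f i) U.negReflect : ℝ) : ℂ) *
        ((obsProd S k σ' (D'.f j) (torusTimeShift (S.side k) (s k) U) : ℝ) : ℂ)
          ∂(wilsonMeasure r.ρ (S.β k)) := by
    intro k
    haveI := isProbabilityMeasure_wilsonMeasure (d := 4) (L := S.side k) r.ρ r.continuous (S.β k)
    have hint : ∀ i j, Integrable (fun U => conj ((obsProd S k σ (D.f i) U.negReflect : ℝ) : ℂ) *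
        ((obsProd S k σ' (D'.f j) (torusTimeShift (S.side k) (s k) U) : ℝ) : ℂ))
        (wilsonMeasure r.ρ (S.β k)) := fun i j =>
      integrable_conj_comp_mul_comp (X := fun U => ((obsProd S k σ (D.f i) U : ℝ) : ℂ))
        (Y := fun U => ((obsProd S k σ' (D'.f j) U : ℝ) : ℂ)) (Θ := GaugeConfig.negReflect)
        (τ := ⇑(torusTimeShift (S.side k) (s k))) WilsonSiteRP.measurable_negReflect
        (torusTimeShift _ _).measurable (SlabSum.measurable_bdd_obsProd S k σ (D.f i)).1
        (SlabSum.measurable_bdd_obsProd S k σ (D.f i)).2 (SlabSum.measurable_bdd_obsProd S k σ' (D'.f j)).1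
        (SlabSum.measurable_bdd_obsProd S k σ' (D'.f j)).2
    have hfun : ∀ U : GaugeConfig 4 (S.side k) G, conj (D.rep S σ k U.negReflect) *
        D'.rep S σ' k (torusTimeShift (S.side k) (s k) U) =
        ∑ i, ∑ j, conj (D.c i) * D'.c j * (conj ((obsProd S k σ (D.f i) U.negReflect : ℝ) : ℂ) *
          ((obsProd S k σ' (D'.f j) (torusTimeShift (S.side k) (s k) U) : ℝ) : ℂ)) := by
      intro U
      simp only [SlabSum.rep, map_sum, map_mul, Finset.sum_mul]
      refine Finset.sum_congr rfl fun i _ => ?_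
      rw [Finset.mul_sum]
      exact Finset.sum_congr rfl fun j _ => by ring
    simp_rw [hfun]
    rw [integral_finsetSum _ fun i _ => integrable_finsetSum _ fun j _ => (hint i j).const_mul _]
    refine Finset.sum_congr rfl fun i _ => ?_
    rw [integral_finsetSum _ fun j _ => (hint i j).const_mul _]
    exact Finset.sum_congr rfl fun j _ => integral_const_mul _ _
  have hT' : T.schwinger (n + m) (Fin.append ((fun i => (σ i).timeReflect) ∘ Fin.rev) σ')
      ((osAdjoint D.sum).appendTensor (translateMulti (EuclideanSpace.single 0 t) D'.sum)) =
      ∑ i, ∑ j, conj (D.c i) * D'.c j *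
        T.schwinger (n + m) (Fin.append ((fun i => (σ i).timeReflect) ∘ Fin.rev) σ')
          ((osAdjoint (D.P i)).appendTensor (translateMulti (EuclideanSpace.single 0 t) (D'.P j))) := by
    rw [SlabSum.osAdjoint_sum, SlabSum.sum, map_sum, SchwartzMap.appendTensor_sum_left, map_sum]
    refine Finset.sum_congr rfl fun i _ => ?_
    rw [SchwartzMap.appendTensor_smul_left, SchwartzMap.appendTensor_sum_right, map_smul, map_sum,
      smul_eq_mul, Finset.mul_sum]
    refine Finset.sum_congr rfl fun j _ => ?_
    rw [map_smul, SchwartzMap.appendTensor_smul_right, map_smul, smul_eq_mul, mul_assoc]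
  rw [hT']
  refine Tendsto.congr (fun k => (hexp k).symm) ?_
  exact tendsto_finsetSum _ fun i _ => tendsto_finsetSum _ fun j _ =>
    (integral_obsProd_reflect_mul_shift_tendsto r hT hsym σ σ' (D.isTensorOf i) (D'.isTensorOf j)
      (D.lo_pos i) (D'.lo_pos j) (D.ord i) (D'.ord j) (D.supp i) (D'.supp j) ht hs).const_mul _


end SlabSums


end Transfer

end Summit.QuantumFields.YangMills.Cruxes.LatticeGapOnTrajectory.OrbitKantorovichFiniteSize

end
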